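import Literature.AlgebraicGeometry.Resolution.MacaulayficationOverCMLocus
import Literature.AlgebraicGeometry.Resolution.BlowupsIntegral
import Literature.AlgebraicGeometry.Resolution.BlowupsProperProofs
import HarnessLib

/-!
# A Cohen–Macaulay blowing up is a Macaulayfication (Česnavičius 2021, Thm 5.3 ⇒ Thm 1.6 ⇒ Kawasaki 2000, Thm 1.1)

Topic: `Literature/AlgebraicGeometry/Resolution`. First (topmost) brick of the proof of the named
facts `KawasakiMacaulayfication` (`Macaulayfication.lean`, Kawasaki 2000 Thm 1.1 in the special
case of an integral scheme of finite type over a field) and `CesnaviciusMacaulayfication`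
(`MacaulayficationOverCMLocus.lean`, Česnavičius 2021 Thm 1.6, same special case).

Both printed proofs END in the same way. Česnavičius 2021, Thm 5.3: *"For a CM-excellent,
locally equidimensional, Noetherian scheme `X` there is a closed subscheme `Z ⊂ X` disjoint from
the dense open `CM(X)` such that `Bl_Z(X)` is Cohen–Macaulay; moreover `Bl_Z(X) → X` is projective,
an isomorphism over `X ∖ Z ⊇ CM(X)`, and `CM(X)` has dense preimage."* and Kawasaki 2000, Thm 5.1
(with Cor. 5.2 / Thm 1.1): the Macaulayfication is obtained as a (composite) blowing up of `X`
along a closed subscheme that misses a dense open. Given such a Cohen–Macaulay blowing up, the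
Macaulayfication statement follows from three generalities about blowing ups that the tree proves
from the universal property (`Blowups*.lean`):

* a blowing up of a locally Noetherian scheme is proper (`IsBlowup.isProper`, Stacks 02NS /
  Görtz–Wedhorn Prop. 13.96 (1));
* a blowing up of an integral scheme along a non-zero ideal sheaf is integral and birational
  (`IsBlowup.isIntegral`, `IsBlowup.isBirational'`, Stacks 02ND, 02OS);
* a blowing up is an isomorphism over every open disjoint from the centre
  (`IsBlowup.isIso_morphismRestrict`, Görtz–Wedhorn Prop. 13.91 (3)).

This file records that deduction, sorry-free and with no new named fact:

* `macaulayfication_of_isBlowup` — for `X` integral and locally of finite type over a field, a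
  blowing up `π : X' → X` along `J ≠ ⊥` all of whose stalks are Cohen–Macaulay (stalkwise inline
  clause of `KawasakiMacaulayfication`: every system of parameters is a weakly regular sequence) is
  proper and birational with `X'` integral and Cohen–Macaulay;
* `isIso_morphismRestrict_of_forall_mem_support` — if, in addition, no point of the centre has a
  Cohen–Macaulay local ring, then `π` is an isomorphism over every open all of whose stalks are
  Cohen–Macaulay (the isomorphism clause of `CesnaviciusMacaulayfication`);
* `kawasakiMacaulayfication_of_exists_isBlowup`,
  `cesnaviciusMacaulayfication_of_exists_isBlowup` — hence the two named facts follow from the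
  existence, for every integral `X` separated and of finite type over a field, of a non-zero ideal
  sheaf `J` (for the second: supported inside the non-Cohen–Macaulay locus) and a blowing up of `X`
  along `J` with Cohen–Macaulay stalks — which is exactly what Česnavičius Thm 5.3 / Kawasaki
  Thm 4.1 + §5 construct, and what remains to be formalized.

## References

* K. Česnavičius, *Macaulayfication of Noetherian schemes*, Duke Math. J. 170 (2021) 1419–1455
  (arXiv:1810.04493v2), Thm 5.3 and its proof ("`X̃ := Bl_Z(X)` … is Cohen–Macaulay … the map
  `π` is an isomorphism over `X ∖ Z`"), Rem. 5.4, Thm 1.6.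
* T. Kawasaki, *On Macaulayfication of Noetherian schemes*, Trans. AMS 352 (2000) 2517–2552,
  Thm 1.1, Thm 4.1, Thm 5.1.
* The Stacks Project, Tags 02NS, 02ND, 02OS; U. Görtz, T. Wedhorn, *Algebraic Geometry I*,
  Prop. 13.91 (3), Prop. 13.96 (1).

## What is NOT here

The construction of the Cohen–Macaulay blowing up (Kawasaki's `p`-standard systems of parameters /
CM-secant sequences, the Cohen–Macaulayness of `Bl_{∏ (x₁,…,xᵢ)}` (Kawasaki Thm 4.1, Česnavičius
Thm 3.13), and the globalization by Noetherian induction (Česnavičius §4–§5)) — the XL remainder.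
-/

noncomputable section

open CategoryTheory AlgebraicGeometry

namespace Literature.AlgebraicGeometry.Resolution

universe u

variable {X' X : Scheme.{u}} {π : X' ⟶ X} {J : X.IdealSheafData}

/-- **A Cohen–Macaulay blowing up of an integral scheme locally of finite type over a field is a
Macaulayfication** (the last step of Česnavičius 2021, proof of Thm 5.3, and of Kawasaki 2000,
Thm 5.1 ⇒ Thm 1.1): if `X` is integral and locally of finite type over the field `k`, `J ≠ ⊥`
is an ideal sheaf and `π : X' → X` is a blowing up of `X` along `J` every stalk of which is
Cohen–Macaulay (every system of parameters a weakly regular sequence), then `π` is proper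
(blowing ups of locally Noetherian schemes are proper) and birational, and `X'` is integral
(Stacks 02ND) and Cohen–Macaulay. [cite: Cesnavicius2021, Thm 5.3 (proof)] -/
theorem macaulayfication_of_isBlowup {k : Type u} [Field k] (f : X ⟶ Spec (.of k))
    [LocallyOfFiniteType f] [IsIntegral X] (hJ : J ≠ ⊥) (hπ : IsBlowup π J)
    (hCM : ∀ x : X', ∀ d : ℕ, ringKrullDim (X'.presheaf.stalk x) = d →
      ∀ s : Fin d → X'.presheaf.stalk x, (Ideal.span (Set.range s)).radical.IsMaximal →
        RingTheory.Sequence.IsWeaklyRegular (X'.presheaf.stalk x) (List.ofFn s)) :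
    IsProper π ∧ IsBirational π ∧ IsIntegral X' ∧
      ∀ x : X', ∀ d : ℕ, ringKrullDim (X'.presheaf.stalk x) = d →
        ∀ s : Fin d → X'.presheaf.stalk x, (Ideal.span (Set.range s)).radical.IsMaximal →
          RingTheory.Sequence.IsWeaklyRegular (X'.presheaf.stalk x) (List.ofFn s) := by
  haveI : IsLocallyNoetherian X := LocallyOfFiniteType.isLocallyNoetherian f
  exact ⟨hπ.isProper, hπ.isBirational' hJ, hπ.isIntegral hJ, hCM⟩

/-- **A blowing up whose centre contains no Cohen–Macaulay point is an isomorphism over every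
Cohen–Macaulay open** (Česnavičius 2021, Thm 5.3: "`Z ∩ CM(X) = ∅` … `π` is an isomorphism over
`X ∖ Z`", with Görtz–Wedhorn Prop. 13.91 (3)): if no point of the support of `J` has a
Cohen–Macaulay local ring, then every open `U ⊆ X` all of whose stalks are Cohen–Macaulay is
disjoint from the centre, so `π ∣_ U` is an isomorphism. [cite: Cesnavicius2021, Thm 5.3 (proof)] -/
theorem isIso_morphismRestrict_of_forall_mem_support (hπ : IsBlowup π J)
    (hZ : ∀ x : X, x ∈ (J.support : Set X) →
      ¬ ∀ d : ℕ, ringKrullDim (X.presheaf.stalk x) = d →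
        ∀ s : Fin d → X.presheaf.stalk x, (Ideal.span (Set.range s)).radical.IsMaximal →
          RingTheory.Sequence.IsWeaklyRegular (X.presheaf.stalk x) (List.ofFn s))
    (U : X.Opens)
    (hU : ∀ x : X, x ∈ U → ∀ d : ℕ, ringKrullDim (X.presheaf.stalk x) = d →
      ∀ s : Fin d → X.presheaf.stalk x, (Ideal.span (Set.range s)).radical.IsMaximal →
        RingTheory.Sequence.IsWeaklyRegular (X.presheaf.stalk x) (List.ofFn s)) :
    IsIso (π ∣_ U) :=
  hπ.isIso_morphismRestrict (Set.disjoint_left.mpr fun x hxU hxJ => hZ x hxJ (hU x hxU))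

/-- **Kawasaki's Macaulayfication (weak form) from a Cohen–Macaulay blowing up**
(Kawasaki 2000, Thm 4.1 + Thm 5.1 ⇒ Thm 1.1; Česnavičius 2021, Thm 5.3 ⇒ Thm 1.6): if every
integral scheme `X` separated and of finite type over a field admits a non-zero ideal sheaf `J`
and a blowing up `π : X' → X` along `J` all of whose stalks are Cohen–Macaulay, then
`KawasakiMacaulayfication` holds. [cite: Kawasaki2000, Thm 1.1 (proof, §5)] -/
theorem kawasakiMacaulayfication_of_exists_isBlowup
    (h : ∀ (k : Type u) [Field k] (X : Scheme.{u}) (f : X ⟶ Spec (.of k)),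
      IsSeparated f → LocallyOfFiniteType f → QuasiCompact f → IsIntegral X →
        ∃ (J : X.IdealSheafData) (X' : Scheme.{u}) (π : X' ⟶ X), J ≠ ⊥ ∧ IsBlowup π J ∧
          ∀ x : X', ∀ d : ℕ, ringKrullDim (X'.presheaf.stalk x) = d →
            ∀ s : Fin d → X'.presheaf.stalk x, (Ideal.span (Set.range s)).radical.IsMaximal →
              RingTheory.Sequence.IsWeaklyRegular (X'.presheaf.stalk x) (List.ofFn s)) :
    KawasakiMacaulayfication.{u} := by
  intro k _ X f hs hl hq hX
  obtain ⟨J, X', π, hJ, hπ, hCM⟩ := h k X f hs hl hq hX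
  exact ⟨X', π, macaulayfication_of_isBlowup f hJ hπ hCM⟩

/-- **Česnavičius's Macaulayfication from a Cohen–Macaulay blowing up centred off the
Cohen–Macaulay locus** (Česnavičius 2021, Thm 5.3 ⇒ Thm 1.6): if every integral scheme `X`
separated and of finite type over a field admits a non-zero ideal sheaf `J`, no point of whose
support has a Cohen–Macaulay local ring, and a blowing up `π : X' → X` along `J` all of whose
stalks are Cohen–Macaulay, then `CesnaviciusMacaulayfication` holds (and hence
`KawasakiMacaulayfication`, by `kawasakiMacaulayfication_of_cesnaviciusMacaulayfication`).
[cite: Cesnavicius2021, Thm 5.3 and Thm 1.6] -/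
theorem cesnaviciusMacaulayfication_of_exists_isBlowup
    (h : ∀ (k : Type u) [Field k] (X : Scheme.{u}) (f : X ⟶ Spec (.of k)),
      IsSeparated f → LocallyOfFiniteType f → QuasiCompact f → IsIntegral X →
        ∃ (J : X.IdealSheafData) (X' : Scheme.{u}) (π : X' ⟶ X), J ≠ ⊥ ∧ IsBlowup π J ∧
          (∀ x : X, x ∈ (J.support : Set X) →
            ¬ ∀ d : ℕ, ringKrullDim (X.presheaf.stalk x) = d →
              ∀ s : Fin d → X.presheaf.stalk x, (Ideal.span (Set.range s)).radical.IsMaximal →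
                RingTheory.Sequence.IsWeaklyRegular (X.presheaf.stalk x) (List.ofFn s)) ∧
          ∀ x : X', ∀ d : ℕ, ringKrullDim (X'.presheaf.stalk x) = d →
            ∀ s : Fin d → X'.presheaf.stalk x, (Ideal.span (Set.range s)).radical.IsMaximal →
              RingTheory.Sequence.IsWeaklyRegular (X'.presheaf.stalk x) (List.ofFn s)) :
    CesnaviciusMacaulayfication.{u} := by
  intro k _ X f hs hl hq hX
  obtain ⟨J, X', π, hJ, hπ, hZ, hCM⟩ := h k X f hs hl hq hX
  obtain ⟨hp, hb, hi, hc⟩ := macaulayfication_of_isBlowup f hJ hπ hCM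
  exact ⟨X', π, hp, hb, hi, hc, isIso_morphismRestrict_of_forall_mem_support hπ hZ⟩

end Literature.AlgebraicGeometry.Resolution

end
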